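import Mathlib.FieldTheory.Galois.Profinite
import Literature.AnabelianGeometry.SemiGraphs.TemperedDLocTransportEquivalence
import Literature.AnabelianGeometry.SemiGraphs.TemperedAnabelianThm68Sub
import Literature.AnabelianGeometry.SemiGraphs.WitnessIwahoriGroup

/-!
# A NON-DEGENERATE inhabitant of the [SemiAnbd] §6 interface: nonabelian `Δ^temp`, a cusp, an object of `DLoc_{G_K}(Π^temp)`, scheme data, and Thm 6.8 (ii) instantiated

Vacuity-lane companion (abc-iut cell, layer L3, seat abc-iut-w5-d040 gen 2, row «WIT-§6») of
`TemperedAnabelian.lean` (abc-iut-L3-t2: the interface `TemperedCurve p`), `TemperedAnabelianMorphisms.lean`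
/ `TemperedDLocCategory.lean` / `TemperedDLocTransport*.lean` (abc-iut-L3-t4: the objects `DLocObj X`,
the genuine category `DLoc_{G_K}(Π^temp_{X_K})`, the scheme-side data `DLocSchemeData X`, and the Thm 6.8
(ii) transport equivalence).  Mochizuki, *Semi-graphs of anabelioids*, Publ. RIMS **42** (2006), §6
pp. 69–75 (author's ms.) [cite: MochizukiSemiAnbd2006, §6 pp.69-75].

The two existing witnesses `TemperedCurve.degenerate` (TemperedAnabelianWitness.lean) and
`TemperedArithmeticGroup.nonempty_of_isAlgClosed` (TemperedCurvesWitness.lean) have `Δ = 1`; their HONEST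
LIMITS paragraphs record that they say nothing about the hyperbolic case, and indeed the type `DLocObj X`
is EMPTY at the degenerate witness (its field `hyperbolic` — "the image of `Δ^temp_X ∩ H` in `J` is
nonabelian", p. 74 — fails).  This file kernel-checks that the §6 axiom set TOGETHER WITH the
`DLoc`-apparatus of Thm 6.8 is jointly satisfiable at a hyperbolic-shaped datum:

* `TemperedCurve.toyHyperbolic p`: `K := ℚ_p`, "`Π^temp`" `:= G_{ℚ_p} × (Ẑ × P)` with `P = ℤ_p ⋊ (1 + pℤ_p)`
  the nonabelian pro-`p` group `Iw p` of `WitnessIwahoriGroup.lean` (abc-iut-w5-d236), augmentation the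
  first projection (so `Δ^temp = 1 × Ẑ × P`, NONABELIAN: `toyHyperbolic_deltaTemp_noncomm`), the group being
  its own profinite completion (`isProfiniteCompletion_id`, generic), ONE closed point which is a CUSP with
  `D_x := G_{ℚ_p} × Ẑ × 1` (closed; `aug(D_x) = G_{ℚ_p}` open; `I_x = 1 × Ẑ × 1 ≃ₜ* Ẑ`, `inertiaEquiv`);
* `DLocObj.toyHyperbolic`: the object `(Π^temp ↠ Π^temp)` (`H = ⊤`, no cusp filled in) — `hyperbolic` PROVED;
* `DLocSchemeData.toyHyperbolic`: genuine-morphism scheme data with a one-object, one-morphism `DLoc_K`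
  mapped to that object, `J ≃ₜ* Π^temp` constructed (`DLocObj.jTopEquiv`);
* consequences: `Nonempty (DLocObj _)`, `Nonempty (DLocSchemeData _)`, a cuspidal geometric decomposition
  group exists, the Thm 6.8 (ii) equivalence clause `TemperedCurve.IsoInducesDLocEquivalence` HOLDS
  UNCONDITIONALLY at this datum for `α = id` (via abc-iut-L3-t4's `isoInducesDLocEquivalence_of`), the closed
  point is of tempered `DLoc`-type (Def. 6.7, `TemperedCurve.IsTemperedDLocType`), the last clause of Thm 6.8
  (ii) (`TemperedCurve.IsoPreservesTemperedDLocType`) holds for `α = id`, and the decomposition groups are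
  compact (`Thm68Sub.DecompCompact`, hypothesis T68-B1 of the Thm 6.8 sub-DAG) — so these typed notions are
  jointly satisfiable with hyperbolicity.

HONEST LIMITS.  Consistency evidence only: the inhabitant is a toy, not André's `π₁^temp` of a curve
(`Π^temp` is a direct product, so `Ẑ` is central: `Π` is not slim and `TemperedCurve.GroupLevelData` is not
inhabited by it; `D_x` is normal of infinite index, so Thm 6.5 (ii)'s `DecompCommensurablyTerminal` FAILS
here; there is exactly one closed point; `Π^temp` is compact).  It is NOT claimed that the hypothesis bundles
of the Thm 6.8 (iii)/(iv) assemblies are satisfiable at this datum.  No statement of the paper is asserted;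
no census node; nothing here takes a side on [IUTchIII] Cor. 3.12.
-/

noncomputable section

namespace Literature.AnabelianGeometry.SemiGraphs

open scoped Pointwise
open CategoryTheory Topology

universe u

/-! ### A profinite group is its own profinite completion -/

/-- For a compact, Hausdorff, totally disconnected topological group `G`, the identity `G → G`
satisfies the interface `IsProfiniteCompletion` (generalises `isProfiniteCompletion_id_GQp` of
TemperedAnabelianWitness.lean). [cite: MochizukiSemiAnbd2006, §6 p.69] -/
theorem isProfiniteCompletion_id (G : Type u) [Group G] [TopologicalSpace G] [IsTopologicalGroup G]
    [CompactSpace G] [T2Space G] [TotallyDisconnectedSpace G] :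
    IsProfiniteCompletion (ContinuousMonoidHom.id G) where
  compactSpace := inferInstance
  t2Space := inferInstance
  totallyDisconnectedSpace := inferInstance
  denseRange := denseRange_id
  comap_surjective U _ := ⟨U, by ext; rfl⟩
  isOpen_comap V := V.isOpen'

variable (p : ℕ) [Fact p.Prime]

/-! ### The toy group `G_{ℚ_p} × (Ẑ × P)` -/

/-- The toy "`Π^temp`": `G_{ℚ_p} × (Ẑ × P)`, `P = ℤ_p ⋊ (1 + pℤ_p)`. [cite: MochizukiSemiAnbd2006, §6 p.69] -/
abbrev ToyPi : Type := GQp p × (ZHat × Iw p)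

/-- The toy decomposition group of the unique closed point (a cusp): `D := G_{ℚ_p} × Ẑ × 1`.
[cite: MochizukiSemiAnbd2006, §6 p.71] -/
def toyDecomp : Subgroup (ToyPi p) := (⊤ : Subgroup (GQp p)).prod ((⊤ : Subgroup ZHat).prod ⊥)

/-- Membership in `D = G_{ℚ_p} × Ẑ × 1`. [cite: MochizukiSemiAnbd2006, §6 p.71] -/
theorem mem_toyDecomp_iff (x : ToyPi p) : x ∈ toyDecomp p ↔ x.2.2 = 1 := by
  simp [toyDecomp, Subgroup.mem_prod]

/-- `D` is closed. [cite: MochizukiSemiAnbd2006, §6 p.71] -/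
theorem isClosed_toyDecomp : IsClosed (toyDecomp p : Set (ToyPi p)) := by
  have : (toyDecomp p : Set (ToyPi p)) = (fun x : ToyPi p => x.2.2) ⁻¹' {1} := by
    ext x; simpa using mem_toyDecomp_iff p x
  rw [this]
  exact isClosed_singleton.preimage (by fun_prop)

/-- The augmentation (first projection) maps `D` ONTO `G_{ℚ_p}`. [cite: MochizukiSemiAnbd2006, §6 p.71] -/
theorem fst_image_toyDecomp :
    (ContinuousMonoidHom.fst (GQp p) (ZHat × Iw p)) '' (toyDecomp p : Set (ToyPi p)) = Set.univ := by
  refine Set.eq_univ_of_forall fun g => ⟨(g, (1, 1)), ?_, rfl⟩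
  exact (mem_toyDecomp_iff p _).2 rfl

/-- The toy inertia group `I = D ∩ Ker(pr₁) = 1 × Ẑ × 1` is topologically isomorphic to `Ẑ`
("`I_x` is isomorphic to `Ẑ(1)` if `x` is a cusp", p. 71). [cite: MochizukiSemiAnbd2006, §6 p.71] -/
def inertiaEquiv :
    ↥(toyDecomp p ⊓ (ContinuousMonoidHom.fst (GQp p) (ZHat × Iw p)).toMonoidHom.ker) ≃ₜ* ZHat where
  toFun x := x.1.2.1
  invFun z := ⟨(1, (z, 1)), (mem_toyDecomp_iff p _).2 rfl, (MonoidHom.mem_ker).2 rfl⟩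
  left_inv x := by
    obtain ⟨⟨g, z, u⟩, hD, hK⟩ := x
    have hu : u = 1 := (mem_toyDecomp_iff p _).1 hD
    have hg : g = 1 := (MonoidHom.mem_ker).1 hK
    subst hu; subst hg; rfl
  right_inv z := rfl
  map_mul' x y := rfl
  continuous_toFun := by fun_prop
  continuous_invFun := by fun_prop

/-! ### The non-degenerate `TemperedCurve` -/

/-- **A non-degenerate inhabitant of `TemperedCurve p`**: base field `ℚ_p`, "`Π^temp`" `:= G_{ℚ_p} × (Ẑ × P)`
with the first projection as augmentation (so `Δ^temp = 1 × Ẑ × P` is NONABELIAN), itself as profinite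
completion, and ONE closed point, a cusp, with `D_x = G_{ℚ_p} × Ẑ × 1`, `I_x ≅ Ẑ`.
[cite: MochizukiSemiAnbd2006, §6 pp.69-71] -/
def TemperedCurve.toyHyperbolic : TemperedCurve p where
  K := ⊥
  finiteDimensional_K := inferInstance
  PiTemp := ToyPi p
  aug := ContinuousMonoidHom.fst _ _
  range_aug := by
    rw [IntermediateField.fixingSubgroup_bot]
    exact MonoidHom.range_eq_top.mpr Prod.fst_surjective
  PiHat := ToyPi p
  toHat := ContinuousMonoidHom.id _
  isProfiniteCompletion_toHat := by
    haveI : IsGalois ℚ_[p] (AlgebraicClosure ℚ_[p]) := {}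
    haveI : T2Space (GQp p) := krullTopology_t2
    exact isProfiniteCompletion_id _
  toHat_injective := Function.injective_id
  augHat := ContinuousMonoidHom.fst _ _
  augHat_comp _ := rfl
  Pt := Unit
  IsCusp _ := True
  decomp _ := toyDecomp p
  isClosed_decomp _ := by
    haveI : IsGalois ℚ_[p] (AlgebraicClosure ℚ_[p]) := {}
    haveI : T2Space (GQp p) := krullTopology_t2
    exact isClosed_toyDecomp p
  isOpen_aug_decomp _ := by
    change IsOpen ((ContinuousMonoidHom.fst (GQp p) (ZHat × Iw p)) '' (toyDecomp p : Set (ToyPi p)))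
    rw [fst_image_toyDecomp]
    exact isOpen_univ
  inertia_eq_bot _ h := (h trivial).elim
  inertia_equiv_zHat _ _ := ⟨inertiaEquiv p⟩

namespace TemperedCurve

/-- `Δ^temp` of the toy is the kernel of the first projection. [cite: MochizukiSemiAnbd2006, §6 p.69] -/
theorem mem_toyHyperbolic_deltaTemp_iff (x : (toyHyperbolic p).PiTemp) :
    x ∈ (toyHyperbolic p).DeltaTemp ↔ x.1 = 1 :=
  MonoidHom.mem_ker

/-- Two non-commuting elements of `P = ℤ_p ⋊ (1 + pℤ_p)`: `(0, 1)·(1, 0)` has translation part `1 + p`,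
`(1, 0)·(0, 1)` has translation part `1`. [cite: MochizukiSemiAnbd2006, §6 p.69] -/
theorem Iw_noncomm : (⟨0, 1⟩ : Iw p) * ⟨1, 0⟩ ≠ ⟨1, 0⟩ * ⟨0, 1⟩ := by
  intro h
  have ha := congrArg Iw.a h
  simp only [Iw.mul_a, IwahoriWitness.w, mul_one, mul_zero, add_zero, zero_add] at ha
  have : (p : ℤ_[p]) = 0 := by
    have := congrArg (fun t : ℤ_[p] => t - 1) ha
    simpa using this
  exact Iw.p_ne_zero this

/-- **`Δ^temp` of the toy is NONABELIAN.** [cite: MochizukiSemiAnbd2006, §6 p.69] -/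
theorem toyHyperbolic_deltaTemp_noncomm :
    ∃ a ∈ (toyHyperbolic p).DeltaTemp, ∃ b ∈ (toyHyperbolic p).DeltaTemp, a * b ≠ b * a := by
  refine ⟨(1, (1, ⟨0, 1⟩)), (mem_toyHyperbolic_deltaTemp_iff p _).2 rfl,
    (1, (1, ⟨1, 0⟩)), (mem_toyHyperbolic_deltaTemp_iff p _).2 rfl, fun h => ?_⟩
  have h' : ((1, (1, ⟨0, 1⟩)) * (1, (1, ⟨1, 0⟩)) : ToyPi p) = (1, (1, ⟨1, 0⟩)) * (1, (1, ⟨0, 1⟩)) := h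
  exact Iw_noncomm p (by simpa using congrArg (fun x : ToyPi p => x.2.2) h')

/-- The unique closed point of the toy is a cusp. [cite: MochizukiSemiAnbd2006, §6 p.71] -/
theorem toyHyperbolic_isCusp (x : (toyHyperbolic p).Pt) : (toyHyperbolic p).IsCusp x := trivial

/-- Hence a cuspidal geometric decomposition group EXISTS over the toy (the notion quantified over by
Thm 6.5 (iii) / the `DLoc` transport hypotheses is not vacuous here). [cite: MochizukiSemiAnbd2006, §6 p.71] -/
theorem toyHyperbolic_isCuspidalGeometricDecompositionGroup :
    (toyHyperbolic p).IsCuspidalGeometricDecompositionGroup ((toyHyperbolic p).inertia ()) :=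
  ⟨(), trivial, 1, (one_smul _ _).symm⟩

end TemperedCurve

/-! ### An object of `DLoc_{G_K}(Π^temp)` over the toy -/

namespace DLocObj

/-- The kernel attached to `H = ⊤` and NO generating cusp (the defining expression of `DLocObj.N_eq`).
[cite: MochizukiSemiAnbd2006, §6 p.74] -/
def toyN : Subgroup (TemperedCurve.toyHyperbolic p).PiTemp :=
  ((Subgroup.normalClosure
    (⋃ I ∈ (∅ : Set (Subgroup (TemperedCurve.toyHyperbolic p).PiTemp)),
      ((I.subgroupOf ⊤ : Subgroup (⊤ : Subgroup (TemperedCurve.toyHyperbolic p).PiTemp)) :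
        Set (⊤ : Subgroup (TemperedCurve.toyHyperbolic p).PiTemp)))).topologicalClosure).map
    (⊤ : Subgroup (TemperedCurve.toyHyperbolic p).PiTemp).subtype

/-- With no cusp filled in, the kernel is trivial (closure of the normal closure of `∅` in a Hausdorff
group). [cite: MochizukiSemiAnbd2006, §6 p.74] -/
theorem toyN_eq_bot : toyN p = ⊥ := by
  haveI : IsGalois ℚ_[p] (AlgebraicClosure ℚ_[p]) := {}
  haveI : T2Space (GQp p) := krullTopology_t2
  haveI : T2Space (TemperedCurve.toyHyperbolic p).PiTemp := by
    change T2Space (ToyPi p); infer_instance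
  unfold toyN
  rw [Set.biUnion_empty]
  have h1 : Subgroup.normalClosure (∅ : Set (⊤ : Subgroup (TemperedCurve.toyHyperbolic p).PiTemp)) = ⊥ :=
    le_bot_iff.mp (Subgroup.normalClosure_le_normal (Set.empty_subset _))
  rw [h1]
  have h2 : (⊥ : Subgroup (⊤ : Subgroup (TemperedCurve.toyHyperbolic p).PiTemp)).topologicalClosure = ⊥ :=
    le_bot_iff.mp (Subgroup.topologicalClosure_minimal _ le_rfl
      (by rw [Subgroup.coe_bot]; exact isClosed_singleton))
  rw [h2, Subgroup.map_bot]

/-- **An object of `DLoc_{G_{ℚ_p}}(Π^temp)` over the toy**: `H := Π^temp` itself, no cusp filled in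
(`J = Π^temp`); "`J` is hyperbolic" holds because `Δ^temp` is nonabelian.
[cite: MochizukiSemiAnbd2006, §6 pp.73-74] -/
def toyHyperbolic : DLocObj (TemperedCurve.toyHyperbolic p) where
  H := ⊤
  isOpen_H := by rw [Subgroup.coe_top]; exact isOpen_univ
  finiteIndex_H := inferInstance
  gens := ∅
  gens_cuspidal := fun _ h => h.elim
  N := toyN p
  N_eq := rfl
  hyperbolic h := by
    obtain ⟨a, ha, b, hb, hab⟩ := TemperedCurve.toyHyperbolic_deltaTemp_noncomm p
    have := h a ⟨ha, Subgroup.mem_top a⟩ b ⟨hb, Subgroup.mem_top b⟩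
    rw [toyN_eq_bot, Subgroup.mem_bot, ← commutatorElement_def,
      commutatorElement_eq_one_iff_mul_comm] at this
    exact hab this

/-- `DLoc_{G_{ℚ_p}}(Π^temp)` over the toy is NONEMPTY. [cite: MochizukiSemiAnbd2006, §6 pp.73-74] -/
theorem nonempty_toyHyperbolic : Nonempty (DLocObj (TemperedCurve.toyHyperbolic p)) := ⟨toyHyperbolic p⟩

/-- Its kernel is trivial. [cite: MochizukiSemiAnbd2006, §6 p.74] -/
theorem toyHyperbolic_N : (toyHyperbolic p).N = ⊥ := toyN_eq_bot p

/-- … hence so is `N ∩ H ⊆ H`. [cite: MochizukiSemiAnbd2006, §6 p.74] -/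
theorem toyHyperbolic_NH : (toyHyperbolic p).NH = ⊥ := by
  rw [NH_eq, toyHyperbolic_N, Subgroup.bot_subgroupOf]

/-- The underlying homomorphism `J = Π^temp/1 → Π^temp` of the identification of `J` with `Π^temp`.
[cite: MochizukiSemiAnbd2006, §6 p.74] -/
def jTopHom : (toyHyperbolic p).J →* (TemperedCurve.toyHyperbolic p).PiTemp :=
  QuotientGroup.lift (toyHyperbolic p).NH (⊤ : Subgroup _).subtype (by
    rw [toyHyperbolic_NH]; exact bot_le)

/-- Its inverse `Π^temp → Π^temp = H ↠ J`. [cite: MochizukiSemiAnbd2006, §6 p.74] -/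
def jTopInv : (TemperedCurve.toyHyperbolic p).PiTemp →* (toyHyperbolic p).J :=
  (QuotientGroup.mk' (toyHyperbolic p).NH).comp (Subgroup.topEquiv.symm.toMonoidHom)

/-- `jTopInv ∘ jTopHom = id`. [cite: MochizukiSemiAnbd2006, §6 p.74] -/
theorem jTopInv_comp_jTopHom : (jTopInv p).comp (jTopHom p) = MonoidHom.id _ :=
  QuotientGroup.monoidHom_ext _ (by ext h; rfl)

/-- `jTopHom ∘ jTopInv = id`. [cite: MochizukiSemiAnbd2006, §6 p.74] -/
theorem jTopHom_comp_jTopInv : (jTopHom p).comp (jTopInv p) = MonoidHom.id _ := by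
  ext x; rfl

/-- **The identification `J ≃ₜ* Π^temp`** of the toy object (the datum `objIso` of the scheme side).
[cite: MochizukiSemiAnbd2006, §6 p.74] -/
def jTopEquiv : (toyHyperbolic p).J ≃ₜ* (TemperedCurve.toyHyperbolic p).PiTemp where
  toMulEquiv := MonoidHom.toMulEquiv (jTopHom p) (jTopInv p) (jTopInv_comp_jTopHom p)
    (jTopHom_comp_jTopInv p)
  continuous_toFun := by
    refine (QuotientGroup.isQuotientMap_mk (toyHyperbolic p).NH).continuous_iff.2 ?_
    exact continuous_subtype_val
  continuous_invFun := by
    change Continuous (jTopInv p)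
    exact QuotientGroup.continuous_mk.comp (Continuous.subtype_mk continuous_id _)

/-- `jTopEquiv` sends the class of `h ∈ H = Π^temp` to `h`. [cite: MochizukiSemiAnbd2006, §6 p.74] -/
@[simp] theorem jTopEquiv_proj (h : (toyHyperbolic p).H) :
    jTopEquiv p ((toyHyperbolic p).proj h) = (h : (TemperedCurve.toyHyperbolic p).PiTemp) := rfl

end DLocObj

/-! ### Genuine-morphism scheme data over the toy -/

/-- The object type of the toy `DLoc_K(X_K)`: one object (standing for `X_K` itself).
[cite: MochizukiSemiAnbd2006, §6 p.73] -/
inductive ToyDLocK : Type 1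
  | self : ToyDLocK

namespace ToyDLocK

/-- One object, one morphism. [cite: MochizukiSemiAnbd2006, §6 p.73] -/
instance : Category.{0} ToyDLocK where
  Hom _ _ := Unit
  id _ := ()
  comp _ _ := ()

end ToyDLocK

/-- **Genuine-morphism scheme data over the toy** (`DLocSchemeData`): `DLoc_K` with one object and one
morphism, "the tempered fundamental group functor" the constant functor at the object
`DLocObj.toyHyperbolic` (`H = ⊤`, `gens = ∅`), `J ≅ Π^temp` via `jTopEquiv`; every compatibility field
PROVED. [cite: MochizukiSemiAnbd2006, §6 pp.73-74] -/
def DLocSchemeData.toyHyperbolic : DLocSchemeData (TemperedCurve.toyHyperbolic p) :=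
  letI := DLocObj.dlocCategory (TemperedCurve.toyHyperbolic p)
  { DLocK := ToyDLocK
    self := ToyDLocK.self
    curve := fun _ => TemperedCurve.toyHyperbolic p
    pi1 := fun _ => ContinuousMonoidHom.id _
    selfIso := ContinuousMulEquiv.refl _
    pi1Functor := (Functor.const ToyDLocK).obj (DLocObj.toyHyperbolic p)
    pi1Functor_self_H := rfl
    pi1Functor_self_gens := rfl
    objIso := fun _ => DLocObj.jTopEquiv p
    map_objIso := fun f => ⟨DLocObj.HomRep.id _, rfl, 1, fun j => by simp [DLocObj.HomRep.id]⟩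
    selfIso_objIso := fun h => rfl }

/-- `DLocSchemeData` over the toy is NONEMPTY. [cite: MochizukiSemiAnbd2006, §6 pp.73-74] -/
theorem DLocSchemeData.nonempty_toyHyperbolic :
    Nonempty (DLocSchemeData (TemperedCurve.toyHyperbolic p)) :=
  ⟨DLocSchemeData.toyHyperbolic p⟩

/-! ### Thm 6.8 (ii), equivalence clause, INSTANTIATED at the toy -/

/-- (hΔ) at `α = id`: trivially `id(Δ^temp) = Δ^temp`. [cite: MochizukiSemiAnbd2006, Thm 6.8(ii) p.74] -/
theorem map_refl_eq {G : Type u} [Group G] [TopologicalSpace G] (I : Subgroup G) :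
    I.map (ContinuousMulEquiv.refl G).toMulEquiv.toMonoidHom = I := by
  ext x
  constructor
  · rintro ⟨y, hy, rfl⟩; exact hy
  · intro hx; exact ⟨x, hx, rfl⟩

/-- **[SemiAnbd] Thm 6.8 (ii), equivalence clause, HOLDS UNCONDITIONALLY at the toy** for `α = id`:
the transport equivalence `DLoc_{G_K}(Π^temp) ≌ DLoc_{G_K}(Π^temp)` of abc-iut-L3-t4's
`isoInducesDLocEquivalence_of`, its two hypotheses (hΔ), (hI) being trivially true for the identity —
so the typed clause `TemperedCurve.IsoInducesDLocEquivalence` is inhabited at SOME genuine-morphism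
context with nonempty object type. [cite: MochizukiSemiAnbd2006, Thm 6.8(ii) p.74] -/
theorem TemperedCurve.isoInducesDLocEquivalence_toyHyperbolic_refl :
    (TemperedCurve.toyHyperbolic p).IsoInducesDLocEquivalence (TemperedCurve.toyHyperbolic p)
      (DLocSchemeData.toyHyperbolic p).toDLocContext (DLocSchemeData.toyHyperbolic p).toDLocContext
      (ContinuousMulEquiv.refl _) :=
  isoInducesDLocEquivalence_of _ _ _ (map_refl_eq _) fun I => by rw [map_refl_eq]

/-! ### Def 6.7 and the last clause of Thm 6.8 (ii) at the toy; compactness of decomposition groups -/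

/-- The image of `D_x` under `π₁(id) = id` and `selfIso = id`, twisted by `γ = 1`, is `D_x`.
[cite: MochizukiSemiAnbd2006, Def 6.7 p.74] -/
theorem toyDecomp_img_eq :
    (1 : ConjAct (TemperedCurve.toyHyperbolic p).PiTemp) •
      ((toyDecomp p : Subgroup (TemperedCurve.toyHyperbolic p).PiTemp).map
          (ContinuousMonoidHom.id (TemperedCurve.toyHyperbolic p).PiTemp).toMonoidHom).map
        (ContinuousMulEquiv.refl (TemperedCurve.toyHyperbolic p).PiTemp).toMulEquiv.toMonoidHom =
      toyDecomp p := by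
  rw [one_smul, map_refl_eq]
  ext x
  constructor
  · rintro ⟨y, hy, rfl⟩; exact hy
  · intro hx; exact ⟨x, hx, rfl⟩

/-- **Def 6.7 is satisfiable at the toy**: its (unique, cuspidal) closed point is of tempered `DLoc`-type
for the genuine-morphism data — witness `Z = X_K`, `f = id`, `D_z = D_x`, `γ = 1`.
[cite: MochizukiSemiAnbd2006, Def 6.7 p.74] -/
theorem TemperedCurve.isTemperedDLocType_toyHyperbolic (x : (TemperedCurve.toyHyperbolic p).Pt) :
    (TemperedCurve.toyHyperbolic p).IsTemperedDLocType (DLocSchemeData.toyHyperbolic p).toDLocContext x := by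
  suffices h : ∀ S : Subgroup (TemperedCurve.toyHyperbolic p).PiTemp, S = toyDecomp p →
      (S ≤ (TemperedCurve.toyHyperbolic p).decomp x ∧
        IsOpen ((S.subgroupOf ((TemperedCurve.toyHyperbolic p).decomp x) :
          Subgroup ((TemperedCurve.toyHyperbolic p).decomp x)) :
            Set ((TemperedCurve.toyHyperbolic p).decomp x))) from
    ⟨ToyDLocK.self, (), toyDecomp p, 1, ⟨(), trivial, 1, (one_smul _ _).symm⟩, h _ (toyDecomp_img_eq p)⟩
  rintro S rfl
  refine ⟨le_rfl, ?_⟩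
  change IsOpen (((toyDecomp p).subgroupOf (toyDecomp p) : Subgroup (toyDecomp p)) : Set (toyDecomp p))
  rw [Subgroup.subgroupOf_self, Subgroup.coe_top]
  exact isOpen_univ

/-- **The last clause of Thm 6.8 (ii) ("`α` preserves the decomposition groups of tempered `DLoc`-type")
is satisfiable**: it holds at the toy for `α = id`. [cite: MochizukiSemiAnbd2006, Thm 6.8(ii) p.74] -/
theorem TemperedCurve.isoPreservesTemperedDLocType_toyHyperbolic_refl :
    (TemperedCurve.toyHyperbolic p).IsoPreservesTemperedDLocType (TemperedCurve.toyHyperbolic p)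
      (DLocSchemeData.toyHyperbolic p).toDLocContext (DLocSchemeData.toyHyperbolic p).toDLocContext
      (ContinuousMulEquiv.refl _) := by
  intro x hx
  refine ⟨x, hx, 1, ?_⟩
  rw [one_smul, map_refl_eq]

/-- The decomposition groups of the toy are COMPACT — the hypothesis predicate `Thm68Sub.DecompCompact`
(T68-B1 of the Thm 6.8 sub-DAG) is satisfiable jointly with hyperbolicity.
[cite: MochizukiSemiAnbd2006, §6 p.71] -/
theorem TemperedCurve.decompCompact_toyHyperbolic : Thm68Sub.DecompCompact (TemperedCurve.toyHyperbolic p) := by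
  haveI : IsGalois ℚ_[p] (AlgebraicClosure ℚ_[p]) := {}
  haveI : T2Space (GQp p) := krullTopology_t2
  haveI : CompactSpace (TemperedCurve.toyHyperbolic p).PiTemp := by
    change CompactSpace (ToyPi p); infer_instance
  intro x
  exact (isClosed_toyDecomp p).isCompact

end Literature.AnabelianGeometry.SemiGraphs

end
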